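import Summits.Ventures.YMGap.FlowData.PlaquetteCharacterTail
import HarnessLib

/-!
# Venture YMGap, track Y3 FLOW-DATA — plaquette-tail constants of the lineage-A table, part B: the TAIL-R `2β` upper builds, the §10.8 SHELL builds, the screen blocks, and the 3×3 β = 3/2 point

HONEST FRAMING: venture file of the cell `pub-ymgap` (QuantumFields programme), track Y3, lineage A (seat flow-eng-1).  Pure
rational arithmetic on partial power sums of modified Bessel functions; NO lattice statement, no number of record, nothing about
limits or a mass gap.  Companion of `PlaquetteCharacterTailInstances` (the ten main-bracket constants): each theorem certifies,
inside Lean, one sup-norm character-tail constant `τ = τ_N(b)/c₀(b)` that the lineage-A engine (sntm) uses in a build OTHER than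
the fine main bracket — the relative kinetic tail's upper build at plaquette coupling `2β` (ENGINE.md §10, task JSON
`constants.tailR.tau2b_hi`), the threshold SHELL's crude upper build (§10.8, `tailR.shell.tau`), the coarse screen blocks — plus
the main-bracket constant of the 3×3 β = 3/2 point (2J ≤ 8).  Same mechanism as part A: `PlaquetteCharacterTail.tailSum_div_charCoeff_le`
with the rational Bessel enclosures `besselI_le_sum_range_add` (K power-series terms + geometric remainder) and
`sum_range_besselTerm_le`; every bound is within 1 % above the engine's interval-arithmetic value.

| theorem | b | characters kept | bound | engine `tau_hi` | use |
|---|---|---|---|---|---|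
| `tau_le_threeHalves_nine` | 3/2 | 2J ≤ 8 | 1.82e-06 | 1.8111e-06 | 3×3 β = 3/2 main bracket 2J ≤ 8 (j231029, the g12 NEW point) |
| `tau_le_threeHalves_five` | 3/2 | 2J ≤ 4 | 0.0115 | 0.01143 | 3×3 β = 3/2 SHELL upper build J_sh 4 (j231029) |
| `tau_le_threeHalves_six` | 3/2 | 2J ≤ 5 | 0.00162 | 0.0016101 | TAIL-R 2β-build of the 4×4 ¾ rows (2β = 3/2, 2J ≤ 5) |
| `tau_le_threeQuarters_four` | 3/4 | 2J ≤ 3 | 0.00434 | 0.0043144 | 4×4 β = 3/4 SHELL upper build J_sh 3 (j230099) |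
| `tau_le_threeQuarters_eight` | 3/4 | 2J ≤ 7 | 8.7e-08 | 8.6564e-08 | 4×4 β = 3/4 main brackets 2J ≤ 7 (S′a/S′b legs) |
| `tau_le_half_five` | 1/2 | 2J ≤ 4 | 5.04e-05 | 5.0175e-05 | 4×4 β = 1/2 SHELL J_sh 4 (g11 top-up) · 3×3 ½ screen |
| `tau_le_half_six` | 1/2 | 2J ≤ 5 | 2.43e-06 | 2.417e-06 | TAIL-R 2β-build of the 4×4 ¼ rows (2β = 1/2, 2J ≤ 5) · 2×4/3×3/4×4 ½ screens |
| `tau_le_half_eight` | 1/2 | 2J ≤ 7 | 3.45e-09 | 3.4278e-09 | 3×3 β = 1/2 fine blocks 2J ≤ 7 |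
| `tau_le_one_six` | 1 | 2J ≤ 5 | 0.000152 | 0.00015078 | TAIL-R 2β-builds of the 2×4 ½ and 4×4 ½ rows (2β = 1, 2J ≤ 5) · 2×2/2×3 β = 1 screens |
| `tau_le_one_seven` | 1 | 2J ≤ 6 | 1.22e-05 | 1.2122e-05 | 2×3 / 3×3 β = 1 blocks 2J ≤ 6 |
| `tau_le_one_nine` | 1 | 2J ≤ 8 | 5.18e-08 | 5.1524e-08 | 2×2 β = 1 fine blocks 2J ≤ 8 |
| `tau_le_quarter_five` | 1/4 | 2J ≤ 4 | 1.57e-06 | 1.555e-06 | 4×4 β = 1/4 screen blocks 2J ≤ 4 |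
| `tau_le_two_seven` | 2 | 2J ≤ 6 | 0.0013 | 0.0012908 | TAIL-R 2β-builds of the 2×3 β = 1 and 3×3 β = 1 rows (2β = 2, 2J ≤ 6) · 2×2 β = 2 screens |
| `tau_le_fiveHalves_seven` | 5/2 | 2J ≤ 6 | 0.0054 | 0.0053728 | 2×2 β = 5/2 screen blocks 2J ≤ 6 |
| `tau_le_three_seven` | 3 | 2J ≤ 6 | 0.0166 | 0.016471 | 2×2 β = 3 screen blocks 2J ≤ 6 |
| `tau_le_sevenHalves_six` | 7/2 | 2J ≤ 5 | 0.157 | 0.15545 | 2×2 β = 7/2 SHELL upper build J_sh 5 (g7 hub-local) |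
| `tau_le_four_seven` | 4 | 2J ≤ 6 | 0.0873 | 0.086908 | TAIL-R 2β-build of the 2×2 β = 2 rows (2β = 4, 2J ≤ 6) |
| `tau_le_four_nine` | 4 | 2J ≤ 8 | 0.00525 | 0.0052286 | TAIL-R 2β-build of the 2×3 β = 2 rows (2β = 4, 2J ≤ 8) |
| `tau_le_five_eight` | 5 | 2J ≤ 7 | 0.09 | 0.089565 | TAIL-R 2β-build of the 2×2 β = 5/2 rows (2β = 5, 2J ≤ 7) |
| `tau_le_seven_ten` | 7 | 2J ≤ 9 | 0.0734 | 0.072992 | TAIL-R 2β-build of the 2×2 β = 7/2 rows (2β = 7, 2J ≤ 9) |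

References: I. Montvay, G. Münster (1994) §3.2.6 [cite: MontvayMunster1994, §3.2.6]; Abramowitz–Stegun 9.6.10
[cite: AbramowitzStegun1964, 9.6.10].
-/

noncomputable section

open Finset
open Literature.Analysis.FunctionSpaces
open Summit.Ventures.YMGap.FlowData.PlaquetteCharacterTail

namespace Summit.Ventures.YMGap.FlowData.PlaquetteCharacterTailInstancesB

/-- Worked instance: `τ_9(3 / 2)/c₀ ≤ 182 / 100000000` (engine `tau_hi` = 1.8111e-06; use: 3×3 β = 3/2 main bracket 2J ≤ 8 (j231029, the g12 NEW point)). [cite: MontvayMunster1994, §3.2.6] -/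
theorem tau_le_threeHalves_nine : tailSum (3 / 2) 9 / charCoeff (3 / 2) 0 ≤ 182 / 100000000 := by
  refine (tailSum_div_charCoeff_le (b := 3 / 2) (by norm_num) 9 (by norm_num)
    (besselI_le_sum_range_add 9 3 (by norm_num) (by norm_num))
    (besselI_le_sum_range_add 10 3 (by norm_num) (by norm_num))
    (besselI_le_sum_range_add 11 3 (by norm_num) (by norm_num))
    (sum_range_besselTerm_le 1 4 (by norm_num)) ?_).trans ?_
  · norm_num [besselTerm, Finset.sum_range_succ, Finset.sum_range_zero, Nat.factorial]
  · norm_num [besselTerm, Finset.sum_range_succ, Finset.sum_range_zero, Nat.factorial]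

/-- Worked instance: `τ_5(3 / 2)/c₀ ≤ 115 / 10000` (engine `tau_hi` = 0.01143; use: 3×3 β = 3/2 SHELL upper build J_sh 4 (j231029)). [cite: MontvayMunster1994, §3.2.6] -/
theorem tau_le_threeHalves_five : tailSum (3 / 2) 5 / charCoeff (3 / 2) 0 ≤ 115 / 10000 := by
  refine (tailSum_div_charCoeff_le (b := 3 / 2) (by norm_num) 5 (by norm_num)
    (besselI_le_sum_range_add 5 3 (by norm_num) (by norm_num))
    (besselI_le_sum_range_add 6 3 (by norm_num) (by norm_num))
    (besselI_le_sum_range_add 7 3 (by norm_num) (by norm_num))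
    (sum_range_besselTerm_le 1 4 (by norm_num)) ?_).trans ?_
  · norm_num [besselTerm, Finset.sum_range_succ, Finset.sum_range_zero, Nat.factorial]
  · norm_num [besselTerm, Finset.sum_range_succ, Finset.sum_range_zero, Nat.factorial]

/-- Worked instance: `τ_6(3 / 2)/c₀ ≤ 162 / 100000` (engine `tau_hi` = 0.0016101; use: TAIL-R 2β-build of the 4×4 ¾ rows (2β = 3/2, 2J ≤ 5)). [cite: MontvayMunster1994, §3.2.6] -/
theorem tau_le_threeHalves_six : tailSum (3 / 2) 6 / charCoeff (3 / 2) 0 ≤ 162 / 100000 := by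
  refine (tailSum_div_charCoeff_le (b := 3 / 2) (by norm_num) 6 (by norm_num)
    (besselI_le_sum_range_add 6 3 (by norm_num) (by norm_num))
    (besselI_le_sum_range_add 7 3 (by norm_num) (by norm_num))
    (besselI_le_sum_range_add 8 3 (by norm_num) (by norm_num))
    (sum_range_besselTerm_le 1 4 (by norm_num)) ?_).trans ?_
  · norm_num [besselTerm, Finset.sum_range_succ, Finset.sum_range_zero, Nat.factorial]
  · norm_num [besselTerm, Finset.sum_range_succ, Finset.sum_range_zero, Nat.factorial]

/-- Worked instance: `τ_4(3 / 4)/c₀ ≤ 434 / 100000` (engine `tau_hi` = 0.0043144; use: 4×4 β = 3/4 SHELL upper build J_sh 3 (j230099)). [cite: MontvayMunster1994, §3.2.6] -/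
theorem tau_le_threeQuarters_four : tailSum (3 / 4) 4 / charCoeff (3 / 4) 0 ≤ 434 / 100000 := by
  refine (tailSum_div_charCoeff_le (b := 3 / 4) (by norm_num) 4 (by norm_num)
    (besselI_le_sum_range_add 4 2 (by norm_num) (by norm_num))
    (besselI_le_sum_range_add 5 2 (by norm_num) (by norm_num))
    (besselI_le_sum_range_add 6 2 (by norm_num) (by norm_num))
    (sum_range_besselTerm_le 1 3 (by norm_num)) ?_).trans ?_
  · norm_num [besselTerm, Finset.sum_range_succ, Finset.sum_range_zero, Nat.factorial]
  · norm_num [besselTerm, Finset.sum_range_succ, Finset.sum_range_zero, Nat.factorial]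

/-- Worked instance: `τ_8(3 / 4)/c₀ ≤ 870 / 10000000000` (engine `tau_hi` = 8.6564e-08; use: 4×4 β = 3/4 main brackets 2J ≤ 7 (S′a/S′b legs)). [cite: MontvayMunster1994, §3.2.6] -/
theorem tau_le_threeQuarters_eight : tailSum (3 / 4) 8 / charCoeff (3 / 4) 0 ≤ 870 / 10000000000 := by
  refine (tailSum_div_charCoeff_le (b := 3 / 4) (by norm_num) 8 (by norm_num)
    (besselI_le_sum_range_add 8 2 (by norm_num) (by norm_num))
    (besselI_le_sum_range_add 9 2 (by norm_num) (by norm_num))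
    (besselI_le_sum_range_add 10 2 (by norm_num) (by norm_num))
    (sum_range_besselTerm_le 1 3 (by norm_num)) ?_).trans ?_
  · norm_num [besselTerm, Finset.sum_range_succ, Finset.sum_range_zero, Nat.factorial]
  · norm_num [besselTerm, Finset.sum_range_succ, Finset.sum_range_zero, Nat.factorial]

/-- Worked instance: `τ_5(1 / 2)/c₀ ≤ 504 / 10000000` (engine `tau_hi` = 5.0175e-05; use: 4×4 β = 1/2 SHELL J_sh 4 (g11 top-up) · 3×3 ½ screen). [cite: MontvayMunster1994, §3.2.6] -/
theorem tau_le_half_five : tailSum (1 / 2) 5 / charCoeff (1 / 2) 0 ≤ 504 / 10000000 := by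
  refine (tailSum_div_charCoeff_le (b := 1 / 2) (by norm_num) 5 (by norm_num)
    (besselI_le_sum_range_add 5 2 (by norm_num) (by norm_num))
    (besselI_le_sum_range_add 6 2 (by norm_num) (by norm_num))
    (besselI_le_sum_range_add 7 2 (by norm_num) (by norm_num))
    (sum_range_besselTerm_le 1 3 (by norm_num)) ?_).trans ?_
  · norm_num [besselTerm, Finset.sum_range_succ, Finset.sum_range_zero, Nat.factorial]
  · norm_num [besselTerm, Finset.sum_range_succ, Finset.sum_range_zero, Nat.factorial]

/-- Worked instance: `τ_6(1 / 2)/c₀ ≤ 243 / 100000000` (engine `tau_hi` = 2.417e-06; use: TAIL-R 2β-build of the 4×4 ¼ rows (2β = 1/2, 2J ≤ 5) · 2×4/3×3/4×4 ½ screens). [cite: MontvayMunster1994, §3.2.6] -/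
theorem tau_le_half_six : tailSum (1 / 2) 6 / charCoeff (1 / 2) 0 ≤ 243 / 100000000 := by
  refine (tailSum_div_charCoeff_le (b := 1 / 2) (by norm_num) 6 (by norm_num)
    (besselI_le_sum_range_add 6 2 (by norm_num) (by norm_num))
    (besselI_le_sum_range_add 7 2 (by norm_num) (by norm_num))
    (besselI_le_sum_range_add 8 2 (by norm_num) (by norm_num))
    (sum_range_besselTerm_le 1 3 (by norm_num)) ?_).trans ?_
  · norm_num [besselTerm, Finset.sum_range_succ, Finset.sum_range_zero, Nat.factorial]
  · norm_num [besselTerm, Finset.sum_range_succ, Finset.sum_range_zero, Nat.factorial]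

/-- Worked instance: `τ_8(1 / 2)/c₀ ≤ 345 / 100000000000` (engine `tau_hi` = 3.4278e-09; use: 3×3 β = 1/2 fine blocks 2J ≤ 7). [cite: MontvayMunster1994, §3.2.6] -/
theorem tau_le_half_eight : tailSum (1 / 2) 8 / charCoeff (1 / 2) 0 ≤ 345 / 100000000000 := by
  refine (tailSum_div_charCoeff_le (b := 1 / 2) (by norm_num) 8 (by norm_num)
    (besselI_le_sum_range_add 8 2 (by norm_num) (by norm_num))
    (besselI_le_sum_range_add 9 2 (by norm_num) (by norm_num))
    (besselI_le_sum_range_add 10 2 (by norm_num) (by norm_num))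
    (sum_range_besselTerm_le 1 3 (by norm_num)) ?_).trans ?_
  · norm_num [besselTerm, Finset.sum_range_succ, Finset.sum_range_zero, Nat.factorial]
  · norm_num [besselTerm, Finset.sum_range_succ, Finset.sum_range_zero, Nat.factorial]

/-- Worked instance: `τ_6(1)/c₀ ≤ 152 / 1000000` (engine `tau_hi` = 0.00015078; use: TAIL-R 2β-builds of the 2×4 ½ and 4×4 ½ rows (2β = 1, 2J ≤ 5) · 2×2/2×3 β = 1 screens). [cite: MontvayMunster1994, §3.2.6] -/
theorem tau_le_one_six : tailSum (1) 6 / charCoeff (1) 0 ≤ 152 / 1000000 := by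
  refine (tailSum_div_charCoeff_le (b := 1) (by norm_num) 6 (by norm_num)
    (besselI_le_sum_range_add 6 2 (by norm_num) (by norm_num))
    (besselI_le_sum_range_add 7 2 (by norm_num) (by norm_num))
    (besselI_le_sum_range_add 8 2 (by norm_num) (by norm_num))
    (sum_range_besselTerm_le 1 3 (by norm_num)) ?_).trans ?_
  · norm_num [besselTerm, Finset.sum_range_succ, Finset.sum_range_zero, Nat.factorial]
  · norm_num [besselTerm, Finset.sum_range_succ, Finset.sum_range_zero, Nat.factorial]

/-- Worked instance: `τ_7(1)/c₀ ≤ 122 / 10000000` (engine `tau_hi` = 1.2122e-05; use: 2×3 / 3×3 β = 1 blocks 2J ≤ 6). [cite: MontvayMunster1994, §3.2.6] -/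
theorem tau_le_one_seven : tailSum (1) 7 / charCoeff (1) 0 ≤ 122 / 10000000 := by
  refine (tailSum_div_charCoeff_le (b := 1) (by norm_num) 7 (by norm_num)
    (besselI_le_sum_range_add 7 2 (by norm_num) (by norm_num))
    (besselI_le_sum_range_add 8 2 (by norm_num) (by norm_num))
    (besselI_le_sum_range_add 9 2 (by norm_num) (by norm_num))
    (sum_range_besselTerm_le 1 3 (by norm_num)) ?_).trans ?_
  · norm_num [besselTerm, Finset.sum_range_succ, Finset.sum_range_zero, Nat.factorial]
  · norm_num [besselTerm, Finset.sum_range_succ, Finset.sum_range_zero, Nat.factorial]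

/-- Worked instance: `τ_9(1)/c₀ ≤ 518 / 10000000000` (engine `tau_hi` = 5.1524e-08; use: 2×2 β = 1 fine blocks 2J ≤ 8). [cite: MontvayMunster1994, §3.2.6] -/
theorem tau_le_one_nine : tailSum (1) 9 / charCoeff (1) 0 ≤ 518 / 10000000000 := by
  refine (tailSum_div_charCoeff_le (b := 1) (by norm_num) 9 (by norm_num)
    (besselI_le_sum_range_add 9 2 (by norm_num) (by norm_num))
    (besselI_le_sum_range_add 10 2 (by norm_num) (by norm_num))
    (besselI_le_sum_range_add 11 2 (by norm_num) (by norm_num))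
    (sum_range_besselTerm_le 1 3 (by norm_num)) ?_).trans ?_
  · norm_num [besselTerm, Finset.sum_range_succ, Finset.sum_range_zero, Nat.factorial]
  · norm_num [besselTerm, Finset.sum_range_succ, Finset.sum_range_zero, Nat.factorial]

/-- Worked instance: `τ_5(1 / 4)/c₀ ≤ 157 / 100000000` (engine `tau_hi` = 1.555e-06; use: 4×4 β = 1/4 screen blocks 2J ≤ 4). [cite: MontvayMunster1994, §3.2.6] -/
theorem tau_le_quarter_five : tailSum (1 / 4) 5 / charCoeff (1 / 4) 0 ≤ 157 / 100000000 := by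
  refine (tailSum_div_charCoeff_le (b := 1 / 4) (by norm_num) 5 (by norm_num)
    (besselI_le_sum_range_add 5 2 (by norm_num) (by norm_num))
    (besselI_le_sum_range_add 6 2 (by norm_num) (by norm_num))
    (besselI_le_sum_range_add 7 2 (by norm_num) (by norm_num))
    (sum_range_besselTerm_le 1 3 (by norm_num)) ?_).trans ?_
  · norm_num [besselTerm, Finset.sum_range_succ, Finset.sum_range_zero, Nat.factorial]
  · norm_num [besselTerm, Finset.sum_range_succ, Finset.sum_range_zero, Nat.factorial]

/-- Worked instance: `τ_7(2)/c₀ ≤ 130 / 100000` (engine `tau_hi` = 0.0012908; use: TAIL-R 2β-builds of the 2×3 β = 1 and 3×3 β = 1 rows (2β = 2, 2J ≤ 6) · 2×2 β = 2 screens). [cite: MontvayMunster1994, §3.2.6] -/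
theorem tau_le_two_seven : tailSum (2) 7 / charCoeff (2) 0 ≤ 130 / 100000 := by
  refine (tailSum_div_charCoeff_le (b := 2) (by norm_num) 7 (by norm_num)
    (besselI_le_sum_range_add 7 3 (by norm_num) (by norm_num))
    (besselI_le_sum_range_add 8 3 (by norm_num) (by norm_num))
    (besselI_le_sum_range_add 9 3 (by norm_num) (by norm_num))
    (sum_range_besselTerm_le 1 4 (by norm_num)) ?_).trans ?_
  · norm_num [besselTerm, Finset.sum_range_succ, Finset.sum_range_zero, Nat.factorial]
  · norm_num [besselTerm, Finset.sum_range_succ, Finset.sum_range_zero, Nat.factorial]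

/-- Worked instance: `τ_7(5 / 2)/c₀ ≤ 540 / 100000` (engine `tau_hi` = 0.0053728; use: 2×2 β = 5/2 screen blocks 2J ≤ 6). [cite: MontvayMunster1994, §3.2.6] -/
theorem tau_le_fiveHalves_seven : tailSum (5 / 2) 7 / charCoeff (5 / 2) 0 ≤ 540 / 100000 := by
  refine (tailSum_div_charCoeff_le (b := 5 / 2) (by norm_num) 7 (by norm_num)
    (besselI_le_sum_range_add 7 4 (by norm_num) (by norm_num))
    (besselI_le_sum_range_add 8 4 (by norm_num) (by norm_num))
    (besselI_le_sum_range_add 9 4 (by norm_num) (by norm_num))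
    (sum_range_besselTerm_le 1 6 (by norm_num)) ?_).trans ?_
  · norm_num [besselTerm, Finset.sum_range_succ, Finset.sum_range_zero, Nat.factorial]
  · norm_num [besselTerm, Finset.sum_range_succ, Finset.sum_range_zero, Nat.factorial]

/-- Worked instance: `τ_7(3)/c₀ ≤ 166 / 10000` (engine `tau_hi` = 0.016471; use: 2×2 β = 3 screen blocks 2J ≤ 6). [cite: MontvayMunster1994, §3.2.6] -/
theorem tau_le_three_seven : tailSum (3) 7 / charCoeff (3) 0 ≤ 166 / 10000 := by
  refine (tailSum_div_charCoeff_le (b := 3) (by norm_num) 7 (by norm_num)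
    (besselI_le_sum_range_add 7 4 (by norm_num) (by norm_num))
    (besselI_le_sum_range_add 8 4 (by norm_num) (by norm_num))
    (besselI_le_sum_range_add 9 4 (by norm_num) (by norm_num))
    (sum_range_besselTerm_le 1 6 (by norm_num)) ?_).trans ?_
  · norm_num [besselTerm, Finset.sum_range_succ, Finset.sum_range_zero, Nat.factorial]
  · norm_num [besselTerm, Finset.sum_range_succ, Finset.sum_range_zero, Nat.factorial]

/-- Worked instance: `τ_6(7 / 2)/c₀ ≤ 157 / 1000` (engine `tau_hi` = 0.15545; use: 2×2 β = 7/2 SHELL upper build J_sh 5 (g7 hub-local)). [cite: MontvayMunster1994, §3.2.6] -/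
theorem tau_le_sevenHalves_six : tailSum (7 / 2) 6 / charCoeff (7 / 2) 0 ≤ 157 / 1000 := by
  refine (tailSum_div_charCoeff_le (b := 7 / 2) (by norm_num) 6 (by norm_num)
    (besselI_le_sum_range_add 6 4 (by norm_num) (by norm_num))
    (besselI_le_sum_range_add 7 4 (by norm_num) (by norm_num))
    (besselI_le_sum_range_add 8 4 (by norm_num) (by norm_num))
    (sum_range_besselTerm_le 1 6 (by norm_num)) ?_).trans ?_
  · norm_num [besselTerm, Finset.sum_range_succ, Finset.sum_range_zero, Nat.factorial]
  · norm_num [besselTerm, Finset.sum_range_succ, Finset.sum_range_zero, Nat.factorial]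

/-- Worked instance: `τ_7(4)/c₀ ≤ 873 / 10000` (engine `tau_hi` = 0.086908; use: TAIL-R 2β-build of the 2×2 β = 2 rows (2β = 4, 2J ≤ 6)). [cite: MontvayMunster1994, §3.2.6] -/
theorem tau_le_four_seven : tailSum (4) 7 / charCoeff (4) 0 ≤ 873 / 10000 := by
  refine (tailSum_div_charCoeff_le (b := 4) (by norm_num) 7 (by norm_num)
    (besselI_le_sum_range_add 7 6 (by norm_num) (by norm_num))
    (besselI_le_sum_range_add 8 6 (by norm_num) (by norm_num))
    (besselI_le_sum_range_add 9 6 (by norm_num) (by norm_num))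
    (sum_range_besselTerm_le 1 8 (by norm_num)) ?_).trans ?_
  · norm_num [besselTerm, Finset.sum_range_succ, Finset.sum_range_zero, Nat.factorial]
  · norm_num [besselTerm, Finset.sum_range_succ, Finset.sum_range_zero, Nat.factorial]

/-- Worked instance: `τ_9(4)/c₀ ≤ 525 / 100000` (engine `tau_hi` = 0.0052286; use: TAIL-R 2β-build of the 2×3 β = 2 rows (2β = 4, 2J ≤ 8)). [cite: MontvayMunster1994, §3.2.6] -/
theorem tau_le_four_nine : tailSum (4) 9 / charCoeff (4) 0 ≤ 525 / 100000 := by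
  refine (tailSum_div_charCoeff_le (b := 4) (by norm_num) 9 (by norm_num)
    (besselI_le_sum_range_add 9 6 (by norm_num) (by norm_num))
    (besselI_le_sum_range_add 10 6 (by norm_num) (by norm_num))
    (besselI_le_sum_range_add 11 6 (by norm_num) (by norm_num))
    (sum_range_besselTerm_le 1 8 (by norm_num)) ?_).trans ?_
  · norm_num [besselTerm, Finset.sum_range_succ, Finset.sum_range_zero, Nat.factorial]
  · norm_num [besselTerm, Finset.sum_range_succ, Finset.sum_range_zero, Nat.factorial]

/-- Worked instance: `τ_8(5)/c₀ ≤ 900 / 10000` (engine `tau_hi` = 0.089565; use: TAIL-R 2β-build of the 2×2 β = 5/2 rows (2β = 5, 2J ≤ 7)). [cite: MontvayMunster1994, §3.2.6] -/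
theorem tau_le_five_eight : tailSum (5) 8 / charCoeff (5) 0 ≤ 900 / 10000 := by
  refine (tailSum_div_charCoeff_le (b := 5) (by norm_num) 8 (by norm_num)
    (besselI_le_sum_range_add 8 6 (by norm_num) (by norm_num))
    (besselI_le_sum_range_add 9 6 (by norm_num) (by norm_num))
    (besselI_le_sum_range_add 10 6 (by norm_num) (by norm_num))
    (sum_range_besselTerm_le 1 8 (by norm_num)) ?_).trans ?_
  · norm_num [besselTerm, Finset.sum_range_succ, Finset.sum_range_zero, Nat.factorial]
  · norm_num [besselTerm, Finset.sum_range_succ, Finset.sum_range_zero, Nat.factorial]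

/-- Worked instance: `τ_10(7)/c₀ ≤ 734 / 10000` (engine `tau_hi` = 0.072992; use: TAIL-R 2β-build of the 2×2 β = 7/2 rows (2β = 7, 2J ≤ 9)). [cite: MontvayMunster1994, §3.2.6] -/
theorem tau_le_seven_ten : tailSum (7) 10 / charCoeff (7) 0 ≤ 734 / 10000 := by
  refine (tailSum_div_charCoeff_le (b := 7) (by norm_num) 10 (by norm_num)
    (besselI_le_sum_range_add 10 9 (by norm_num) (by norm_num))
    (besselI_le_sum_range_add 11 9 (by norm_num) (by norm_num))
    (besselI_le_sum_range_add 12 9 (by norm_num) (by norm_num))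
    (sum_range_besselTerm_le 1 12 (by norm_num)) ?_).trans ?_
  · norm_num [besselTerm, Finset.sum_range_succ, Finset.sum_range_zero, Nat.factorial]
  · norm_num [besselTerm, Finset.sum_range_succ, Finset.sum_range_zero, Nat.factorial]

end Summit.Ventures.YMGap.FlowData.PlaquetteCharacterTailInstancesB

end
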